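import Summits.PneNP.PneNP.Statement
import Literature.Computability.Complexity.CookBridges
import Literature.Computability.Complexity.ReductionsProofs
import Literature.Computability.Complexity.NegCNFTranscoder
import Literature.Computability.Complexity.StringCopy
import Literature.Computability.Complexity.EasyWitness
import Literature.Barriers.PneNP.RelativizedCircuitSizeThm4Scope
import HarnessLib

/-!
# The logical shape of `PneNP`: an infinitely-often statement on one fixed language

Soloist file (`solo-PneNP-informed`, summit-directed charter; landing prefix `SoloInformed`).
Nothing here is progress toward `P ≠ NP`; these are kernel-checked SHARPENINGS OF THE SUMMIT
STATEMENT, recording exactly what a proof of `PneNP` is obliged to produce — and what it is not.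

* `soloInformed_mem_P_of_finite_disagreement` — `Classes.P` is closed under finite variation:
  if `D ∈ P` and `L` disagrees with `D` on only finitely many words then `L ∈ P`
  (the disagreement set is a finite language, hence in `P`, and `L = D ∆ {disagreements}`).
* `soloInformed_pneNP_iff_exists_not_mem` — the summit over the prelude classes
  (`∃ L ∈ Nondeterministic.NP, L ∉ Classes.P`), re-derived from Literature-side bridges only; the
  single-language form `PneNP ↔ SAT ∉ P` (Cook–Levin, tree theorem `isNPComplete_SAT_holds`) is
  standard and already in the tree, and is used below only as an internal step.
* `soloInformed_pneNP_iff_infinite_disagreement` — **`PneNP` ↔ some `L ∈ NP` disagrees with EVERY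
  `D ∈ P` on an infinite set of words**; `soloInformed_pneNP_iff_sat_infinitely_often_wrong` — the
  same with `L = SAT` fixed: `P ≠ NP` iff every polynomial-time decidable language errs on `SAT`
  infinitely often. So the summit is an INFINITELY-OFTEN obligation per machine: a proof must
  exhibit, for each `D ∈ P`, infinitely many inputs where `D` misclassifies `SAT` — nothing more.
* `soloInformed_pneNP_of_not_NP_subset_io_P` — the ALMOST-EVERYWHERE form `NP ⊄ io-P` (some NP
  language that no `P` language decides correctly on all words of length `n` except for finitely
  many `n`) implies `PneNP`; the converse (`PneNP → NP ⊄ io-P`) is not known. Almost-everywhere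
  hardness, average-case hardness and non-uniform hardness (`NP ⊄ P/poly`) are each formally MORE
  than the summit asks; the natural-proofs barrier (`Literature.Barriers.PneNP.NaturalProofs`)
  constrains arguments that deliver the non-uniform, all-large-`n` kind.

References: S. Cook, *The P versus NP problem* (Clay, 2000), §1; S. Arora, B. Barak,
*Computational Complexity* (2009), Claim 1.6 / Thm. 2.8 (closure of `P`), Thm. 2.10 (Cook–Levin),
§20.1 (i.o. classes). All ingredients are tree theorems; standard axioms only.
-/

namespace Summit.PneNP.PneNP.Theorems

open Literature.Computability.Complexity

/-- **`P` is closed under finite variation.** If `D ∈ P` and the set of words on which `L` and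
`D` disagree, `{x | x ∈ L ↔ x ∉ D}`, is finite, then `L ∈ P`: the disagreement set `S` is a finite
language, hence in `P` (`Literature.Barriers.PneNP.mem_P_of_finite`), and `L = (D ⊓ Sᶜ) ⊔ (S ⊓ Dᶜ)`
with `P` closed under `⊓`, `⊔`, `ᶜ` (`inter_mem_P`, `union_mem_P`, `compl_mem_P_iff`).
[Arora–Barak 2009, Claim 1.6 / Thm. 2.8] -/
theorem soloInformed_mem_P_of_finite_disagreement {L D : Language Bool} (hD : D ∈ Classes.P)
    (hfin : ({x : List Bool | x ∈ L ↔ x ∉ D} : Set (List Bool)).Finite) : L ∈ Classes.P := by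
  set S : Language Bool := {x : List Bool | x ∈ L ↔ x ∉ D} with hS
  have hSP : S ∈ Classes.P := Literature.Barriers.PneNP.mem_P_of_finite hfin
  have hL : L = (D ⊓ Sᶜ) ⊔ (S ⊓ Dᶜ) := by
    ext x
    change x ∈ L ↔ (x ∈ D ∧ ¬ (x ∈ L ↔ x ∉ D)) ∨ ((x ∈ L ↔ x ∉ D) ∧ x ∉ D)
    by_cases hxD : x ∈ D <;> by_cases hxL : x ∈ L <;> simp [hxD, hxL]
  rw [hL]
  exact union_mem_P (inter_mem_P hD (compl_mem_P_iff.2 hSP))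
    (inter_mem_P hSP (compl_mem_P_iff.2 hD))

/-- The summit over the prelude classes: `PneNP ↔ ∃ L ∈ Nondeterministic.NP, L ∉ Classes.P`
(Cook's classes over `{0,1,#}` equal the prelude's: `CookBridges.np_bool_eq`, `p_bool_eq`).
[Cook, Clay problem description §1] -/
theorem soloInformed_pneNP_iff_exists_not_mem :
    PneNP ↔ ∃ L ∈ Nondeterministic.NP, L ∉ Classes.P := by
  unfold PneNP Literature.PNP.PNeNP
  rw [CookBridges.np_bool_eq, p_bool_eq]

/-- A language never disagrees with itself: `{x | x ∈ L ↔ x ∉ L} = ∅`, in particular finite. -/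
theorem soloInformed_disagreement_self_finite (L : Language Bool) :
    ({x : List Bool | x ∈ L ↔ x ∉ L} : Set (List Bool)).Finite := by
  have he : ({x : List Bool | x ∈ L ↔ x ∉ L} : Set (List Bool)) = ∅ :=
    Set.eq_empty_of_forall_notMem fun x hx => by simp at hx
  rw [he]
  exact Set.finite_empty

/-- **The summit is an infinitely-often statement per machine.** `PneNP` holds iff some
`L ∈ NP` disagrees with every `D ∈ P` on an INFINITE set of words (finitely many disagreements
would put `L` in `P` by `soloInformed_mem_P_of_finite_disagreement`; conversely `L ∉ P` forbids
`D = L`). [Cook, Clay problem description §1; Arora–Barak 2009, Thm. 2.8] -/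
theorem soloInformed_pneNP_iff_infinite_disagreement :
    PneNP ↔ ∃ L ∈ Nondeterministic.NP, ∀ D ∈ Classes.P,
      ({x : List Bool | x ∈ L ↔ x ∉ D} : Set (List Bool)).Infinite := by
  rw [soloInformed_pneNP_iff_exists_not_mem]
  constructor
  · rintro ⟨L, hNP, hP⟩
    exact ⟨L, hNP, fun D hD hfin => hP (soloInformed_mem_P_of_finite_disagreement hD hfin)⟩
  · rintro ⟨L, hNP, h⟩
    exact ⟨L, hNP, fun hP => h L hP (soloInformed_disagreement_self_finite L)⟩

/-- **`P ≠ NP` iff every polynomial-time decidable language errs on `SAT` infinitely often**: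
`PneNP ↔ ∀ D ∈ Classes.P, {x | x ∈ SAT ↔ x ∉ D}` is infinite. This is the exact proof
obligation: for each `D ∈ P`, infinitely many misclassified CNF codes — not almost-everywhere,
average-case or non-uniform hardness. [Arora–Barak 2009, Thm. 2.8 and Thm. 2.10] -/
theorem soloInformed_pneNP_iff_sat_infinitely_often_wrong :
    PneNP ↔ ∀ D ∈ Classes.P, ({x : List Bool | x ∈ SAT ↔ x ∉ D} : Set (List Bool)).Infinite := by
  have hSAT : IsNPComplete SAT := isNPComplete_SAT_holds
  rw [soloInformed_pneNP_iff_infinite_disagreement]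
  constructor
  · rintro ⟨L, hL, h⟩ D hD hfin
    -- finitely many errors of `D` on `SAT` ⇒ `SAT ∈ P` ⇒ `NP ⊆ P` (Cook–Levin) ⇒ `L ∈ P`,
    -- but `L` disagrees with itself nowhere.
    have hSATP : SAT ∈ Classes.P := soloInformed_mem_P_of_finite_disagreement hD hfin
    have hLP : L ∈ Classes.P := NP_subset_P_of_isNPComplete_of_mem_P hSAT hSATP hL
    exact h L hLP (soloInformed_disagreement_self_finite L)
  · intro h
    exact ⟨SAT, hSAT.mem, h⟩

/-- **The almost-everywhere form implies the summit; the converse is not known.** If `NP ⊄ io-P`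
— some `L ∈ NP` such that no `D ∈ P` agrees with `L` on all words of length `n` for infinitely
many `n` (`io`, `Classes.lean`) — then `PneNP`, because `P ⊆ io-P` (`subset_io`). The summit
itself only asks for the infinitely-often failure of each `D`
(`soloInformed_pneNP_iff_infinite_disagreement`). [Arora–Barak 2009, §20.1 (i.o. simulation)] -/
theorem soloInformed_pneNP_of_not_NP_subset_io_P
    (h : ¬ (Nondeterministic.NP ⊆ io Classes.P)) : PneNP := by
  rw [soloInformed_pneNP_iff_exists_not_mem]
  by_contra hne
  refine h fun L hL => subset_io Classes.P ?_
  by_contra hLP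
  exact hne ⟨L, hL, hLP⟩

end Summit.PneNP.PneNP.Theorems
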